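import Summits.ValiantsHypothesis.ValiantsHypothesis.Theorems.BarrierLeverChowBenchmarkPairsDualisation

/-!
# Route BarrierLever — item 22038 `ChowBenchmarkPairs`, line `moore-peel`: the FIRST-ORDER REDUCTION
# of the ∀h stub `stub_segmentMeanValue` — part 1: segment sums over a ring and the `ε`-expansions

Helper file (`--supports stmt-ValiantsHypothesis-22038`; cell valiant-natproofs, rung V4, 𝒟-side
benchmark of record; seat valiant-natproofs-prover gen 15; MEMO-freenode-g15 §10 (a)).  Closes NO item;
definition-free.

The segment-moment matrix of height `h+1` is `N[S,T] = Σ_{g : T → S} ∏_{c∈T} P_{g(c),c} ∏_{a∈S} |g⁻¹(a)|!`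
(rows `S` = the sets of size `≤ 2`, columns `T` = the benchmark codes).  Put the LAST point on a ray
through the origin, `P_{last} = ε·Q`, and keep the other points `P_a`.  Subtracting from every row
`S ∋ last` its partner row `S ∖ {last}` makes those rows divisible by `ε`, and the `ε¹`-coefficients are
the FIRST-ORDER rows `Σ_{c∈T} Q_c · N[S ∖ {last}, T ∖ {c}]` (the functionals `m ↦ E[(D_Q m)(Σ τ_a P_a)]`).
Hence `det N(ε) = ± ε^{h+1} · (det FO + O(ε))`, and

  the reduction theorem `segmentMeanValueAt_of_firstOrder` is in the companion file
  `…ChowBenchmarkPairsFirstOrder`; THIS file carries its ring-level ingredients: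
* `segSumR_empty/_singleton/_pair` — closed forms of the segment sums for `|S| ≤ 2` over any
  commutative ring (ported verbatim from `…ChowBenchmarkPairsDualisation`, which has them over `ℂ`);
  `map_segSum`, `segSum_congr`;
* `coeff_zero_sub_partner_single/_pair`, `coeff_one_sub_partner_single/_pair` — with the last point
  `P'_{last} = X·Q` over `ℂ[X]` and the other points constant, the rows `{last} − ∅` and `{a,last} − {a}`
  have constant coefficient `0` and `X¹`-coefficient equal to the first-order rows.

WHAT THIS IS NOT: the first-order matrices are NOT shown nonsingular here (numerically they are for
every `h ≤ 13`, MEMO-freenode-g15 §10); nothing on items 20172 / 19717, crux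
stmt-ValiantsHypothesis-14610, or `VP` versus `VNP`.
-/

set_option linter.dupNamespace false

namespace Summit.ValiantsHypothesis.ValiantsHypothesis.Theorems.BarrierLever.ChowBenchmarkFirstOrder

open MvPolynomial Finset Polynomial
open Summit.ValiantsHypothesis.ValiantsHypothesis.Theorems.BarrierLever.MoorePeel (benchCols)

/-! ## 1. Segment sums over a commutative ring (ported from `…Dualisation`) -/

section SegSums

variable {R : Type*} [CommRing R] {h : ℕ}

/-- Row `∅`: `segEntry P ∅ T = [T = ∅]` (a map `T → ∅` exists iff `T = ∅`). -/
theorem segSumR_empty (P : Fin h → Fin h → R) (T : Finset (Fin h)) :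
    (∑ g : (↥T → ↥(∅ : Finset (Fin h))), (∏ c : ↥T, P (g c) c) *
        ∏ a : ↥(∅ : Finset (Fin h)),
          ((Finset.univ.filter fun c : ↥T => g c = a).card.factorial : R)) =
      if T = ∅ then 1 else 0 := by
  classical
  by_cases hT : T = ∅
  · subst hT
    rw [if_pos rfl]
    haveI : Unique (↥(∅ : Finset (Fin h)) → ↥(∅ : Finset (Fin h))) := Pi.uniqueOfIsEmpty _
    rw [Fintype.sum_unique]
    simp
  · rw [if_neg hT]
    haveI : Nonempty ↥T := by
      obtain ⟨c, hc⟩ := Finset.nonempty_iff_ne_empty.mpr hT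
      exact ⟨⟨c, hc⟩⟩
    haveI : IsEmpty (↥T → ↥(∅ : Finset (Fin h))) := by infer_instance
    exact Fintype.sum_empty _

/-- Row `{a}`: `segEntry P {a} T = |T|! · ∏_{c∈T} P a c` (the only map is the constant one). -/
theorem segSumR_singleton (P : Fin h → Fin h → R) (a : Fin h) (T : Finset (Fin h)) :
    (∑ g : (↥T → ↥({a} : Finset (Fin h))), (∏ c : ↥T, P (g c) c) *
        ∏ a' : ↥({a} : Finset (Fin h)),
          ((Finset.univ.filter fun c : ↥T => g c = a').card.factorial : R)) =
      (T.card.factorial : R) * ∏ c ∈ T, P a c := by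
  classical
  haveI hU : Unique ↥({a} : Finset (Fin h)) :=
    ⟨⟨⟨a, Finset.mem_singleton_self a⟩⟩, fun x => Subtype.ext (Finset.mem_singleton.mp x.2)⟩
  rw [Fintype.sum_unique]
  set g₀ : ↥T → ↥({a} : Finset (Fin h)) := default with hg₀
  have hg : ∀ c : ↥T, ((g₀ c : ↥({a} : Finset (Fin h))) : Fin h) = a := fun c =>
    Finset.mem_singleton.mp (g₀ c).2
  rw [Fintype.prod_unique (fun a' : ↥({a} : Finset (Fin h)) =>
    ((Finset.univ.filter fun c : ↥T => g₀ c = a').card.factorial : R))]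
  have hfilter : (Finset.univ.filter fun c : ↥T => g₀ c = default) = Finset.univ :=
    Finset.filter_true_of_mem fun c _ => Unique.eq_default _
  rw [hfilter, Finset.card_univ, Fintype.card_coe, mul_comm]
  congr 1
  rw [← Finset.prod_coe_sort T (fun c => P a c)]
  exact Finset.prod_congr rfl fun c _ => by rw [hg c]

/-- Row `{a, b}` (`a ≠ b`): `segEntry P {a,b} T = Σ_{d ⊆ T} |d|!·|T∖d|!·(∏_{c∈d} P a c)(∏_{c∈T∖d} P b c)`
(a map `g : T → {a,b}` is the same as the subset `d = g⁻¹(a) ⊆ T`). -/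
theorem segSumR_pair (P : Fin h → Fin h → R) (a b : Fin h) (hab : a ≠ b) (T : Finset (Fin h)) :
    (∑ g : (↥T → ↥({a, b} : Finset (Fin h))), (∏ c : ↥T, P (g c) c) *
        ∏ a' : ↥({a, b} : Finset (Fin h)),
          ((Finset.univ.filter fun c : ↥T => g c = a').card.factorial : R)) =
      ∑ d ∈ T.powerset, (d.card.factorial : R) * ((T \ d).card.factorial : R) *
        ((∏ c ∈ d, P a c) * ∏ c ∈ T \ d, P b c) := by
  classical
  have ha : a ∈ ({a, b} : Finset (Fin h)) := by simp
  have hb : b ∈ ({a, b} : Finset (Fin h)) := by simp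
  -- the subset `d(g) = g⁻¹(a)` and the map `g(d)`
  let dOf : (↥T → ↥({a, b} : Finset (Fin h))) → Finset (Fin h) := fun g =>
    (Finset.univ.filter fun c : ↥T => ((g c : ↥({a, b} : Finset (Fin h))) : Fin h) = a).map
      (Function.Embedding.subtype _)
  let gOf : Finset (Fin h) → (↥T → ↥({a, b} : Finset (Fin h))) := fun d c =>
    if (c : Fin h) ∈ d then ⟨a, ha⟩ else ⟨b, hb⟩
  have mem_dOf : ∀ g (c : Fin h), c ∈ dOf g ↔ ∃ hc : c ∈ T, ((g ⟨c, hc⟩ : Fin h)) = a := by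
    intro g c
    simp only [dOf, Finset.mem_map, Finset.mem_filter, Finset.mem_univ, true_and,
      Function.Embedding.coe_subtype, Subtype.exists, exists_and_right, exists_eq_right]
  have dOf_sub : ∀ g, dOf g ⊆ T := fun g c hc => ((mem_dOf g c).mp hc).1
  have gval : ∀ (g : ↥T → ↥({a, b} : Finset (Fin h))) (c : ↥T),
      ((g c : Fin h) = a ∧ (c : Fin h) ∈ dOf g) ∨ ((g c : Fin h) = b ∧ (c : Fin h) ∉ dOf g) := by
    intro g c
    rcases Finset.mem_insert.mp (g c).2 with hga | hgb
    · exact Or.inl ⟨hga, (mem_dOf g c).mpr ⟨c.2, by simpa using hga⟩⟩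
    · rw [Finset.mem_singleton] at hgb
      refine Or.inr ⟨hgb, fun hc => ?_⟩
      obtain ⟨hc', e⟩ := (mem_dOf g c).mp hc
      exact hab (by rw [← hgb]; simpa using e.symm)
  refine Finset.sum_bij' (fun g _ => dOf g) (fun d _ => gOf d) ?_ ?_ ?_ ?_ ?_
  · exact fun g _ => Finset.mem_powerset.mpr (dOf_sub g)
  · exact fun d _ => Finset.mem_univ _
  · -- gOf (dOf g) = g
    intro g _
    funext c
    rcases gval g c with ⟨hga, hcd⟩ | ⟨hgb, hcd⟩
    · exact Subtype.ext (by simp only [gOf, if_pos hcd]; exact hga.symm)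
    · exact Subtype.ext (by simp only [gOf, if_neg hcd]; exact hgb.symm)
  · -- dOf (gOf d) = d
    intro d hd
    have hdT : d ⊆ T := Finset.mem_powerset.mp hd
    ext c
    rw [mem_dOf]
    constructor
    · rintro ⟨hc, e⟩
      by_contra hcd
      simp only [gOf, if_neg hcd] at e
      exact hab e.symm
    · intro hcd
      exact ⟨hdT hcd, by simp only [gOf, if_pos hcd]⟩
  · -- the summand
    intro g _
    set d := dOf g with hd
    have hdT : d ⊆ T := dOf_sub g
    -- the product of the table entries
    have hprod : (∏ c : ↥T, P (g c) c) = (∏ c ∈ d, P a c) * ∏ c ∈ T \ d, P b c := by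
      have e1 : (∏ c : ↥T, P (g c) c) = ∏ c : ↥T, (if (c : Fin h) ∈ d then P a c else P b c) := by
        refine Finset.prod_congr rfl fun c _ => ?_
        rcases gval g c with ⟨hga, hcd⟩ | ⟨hgb, hcd⟩
        · rw [if_pos hcd, hga]
        · rw [if_neg hcd, hgb]
      rw [e1, Finset.prod_coe_sort T (fun c => if c ∈ d then P a c else P b c), Finset.prod_ite,
        Finset.filter_mem_eq_inter, Finset.inter_eq_right.mpr hdT, Finset.filter_not,
        Finset.filter_mem_eq_inter, Finset.inter_eq_right.mpr hdT]
    -- the factorial weights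
    have hfa : (Finset.univ.filter fun c : ↥T => ((g c : ↥({a, b} : Finset (Fin h))) : Fin h) = a).card
        = d.card := by
      rw [hd]
      simp only [dOf, Finset.card_map]
    have hfb : (Finset.univ.filter fun c : ↥T => ((g c : ↥({a, b} : Finset (Fin h))) : Fin h) = b).card
        = (T \ d).card := by
      have e1 : (Finset.univ.filter fun c : ↥T => ((g c : ↥({a, b} : Finset (Fin h))) : Fin h) = b) =
          Finset.univ.filter fun c : ↥T => ¬ (((g c : ↥({a, b} : Finset (Fin h))) : Fin h) = a) := by
        ext c
        simp only [Finset.mem_filter, Finset.mem_univ, true_and]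
        rcases gval g c with ⟨hga, _⟩ | ⟨hgb, _⟩
        · rw [hga]
          exact ⟨fun e => absurd e hab, fun ne => absurd rfl ne⟩
        · rw [hgb]
          exact ⟨fun _ => fun e => hab e.symm, fun _ => rfl⟩
      rw [e1, Finset.filter_not, Finset.card_sdiff_of_subset (Finset.filter_subset _ _), hfa,
        Finset.card_univ, Fintype.card_coe, Finset.card_sdiff_of_subset hdT]
    have hw : (∏ a' : ↥({a, b} : Finset (Fin h)),
        ((Finset.univ.filter fun c : ↥T => g c = a').card.factorial : R)) =
        (d.card.factorial : R) * ((T \ d).card.factorial : R) := by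
      have e : ∀ a' : ↥({a, b} : Finset (Fin h)), (Finset.univ.filter fun c : ↥T => g c = a') =
          Finset.univ.filter fun c : ↥T => ((g c : ↥({a, b} : Finset (Fin h))) : Fin h) = (a' : Fin h) :=
        fun a' => by
          ext c
          simp only [Finset.mem_filter, Finset.mem_univ, true_and]
          exact ⟨fun e => by rw [e], fun e => Subtype.ext e⟩
      simp_rw [e]
      rw [Finset.prod_coe_sort ({a, b} : Finset (Fin h)) (fun x : Fin h =>
        ((Finset.univ.filter fun c : ↥T => ((g c : ↥({a, b} : Finset (Fin h))) : Fin h) = x).card.factorial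
          : R)), Finset.prod_pair hab, hfa, hfb]
    rw [hprod, hw]
    ring


/-- A ring homomorphism maps the segment sum of a table to the segment sum of the mapped table. -/
theorem map_segSum {R' : Type*} [CommRing R'] (f : R →+* R') (P : Fin h → Fin h → R)
    (S T : Finset (Fin h)) :
    f (∑ g : (↥T → ↥S), (∏ c : ↥T, P (g c) c) *
        ∏ a : ↥S, ((Finset.univ.filter fun c : ↥T => g c = a).card.factorial : R)) =
      ∑ g : (↥T → ↥S), (∏ c : ↥T, f (P (g c) c)) *
        ∏ a : ↥S, ((Finset.univ.filter fun c : ↥T => g c = a).card.factorial : R') := by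
  simp only [map_sum, map_mul, map_prod, map_natCast]

/-- The segment sum of row `S` against column `T` only reads the table at `S × T`. -/
theorem segSum_congr (P₁ P₂ : Fin h → Fin h → R) (S T : Finset (Fin h))
    (hP : ∀ a ∈ S, ∀ c ∈ T, P₁ a c = P₂ a c) :
    (∑ g : (↥T → ↥S), (∏ c : ↥T, P₁ (g c) c) *
        ∏ a : ↥S, ((Finset.univ.filter fun c : ↥T => g c = a).card.factorial : R)) =
      ∑ g : (↥T → ↥S), (∏ c : ↥T, P₂ (g c) c) *
        ∏ a : ↥S, ((Finset.univ.filter fun c : ↥T => g c = a).card.factorial : R) := by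
  refine Finset.sum_congr rfl fun g _ => ?_
  congr 1
  exact Finset.prod_congr rfl fun c _ => hP _ (g c).2 _ c.2

end SegSums

/-! ## 2. The `ε`-expansion of the rows through the last point (`P_last = X·Q` over `ℂ[X]`) -/

section Expansion

variable {h : ℕ}

/-- A product of `X·C q_c` over a finite set is `C(∏ q_c)·X^{card}`. -/
theorem prod_X_mul_C (q : Fin (h + 1) → ℂ) (s : Finset (Fin (h + 1))) :
    (∏ c ∈ s, (Polynomial.X * Polynomial.C (q c) : ℂ[X])) =
      Polynomial.C (∏ c ∈ s, q c) * Polynomial.X ^ s.card := by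
  rw [Finset.prod_mul_distrib, Finset.prod_const, map_prod, mul_comm]

/-- A product of constants is a constant. -/
theorem prod_C (p : Fin (h + 1) → ℂ) (s : Finset (Fin (h + 1))) :
    (∏ c ∈ s, (Polynomial.C (p c) : ℂ[X])) = Polynomial.C (∏ c ∈ s, p c) := by
  rw [map_prod]

variable (P' : Fin (h + 1) → Fin (h + 1) → ℂ[X]) (Pb : Fin (h + 1) → Fin (h + 1) → ℂ)
  (Q : Fin (h + 1) → ℂ)

/-- **Row `{last}` minus row `∅`**: with `P'_{last,c} = X·Q_c` the difference is
`|T|!·C(∏_T Q)·X^{|T|} − [T = ∅]`; its constant coefficient vanishes. -/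
theorem coeff_zero_sub_partner_single (hlast : ∀ c, P' (Fin.last h) c = Polynomial.X * Polynomial.C (Q c))
    (T : Finset (Fin (h + 1))) :
    ((∑ g : (↥T → ↥({Fin.last h} : Finset (Fin (h + 1)))), (∏ c : ↥T, P' (g c) c) *
        ∏ a : ↥({Fin.last h} : Finset (Fin (h + 1))),
          ((Finset.univ.filter fun c : ↥T => g c = a).card.factorial : ℂ[X])) -
      (∑ g : (↥T → ↥(∅ : Finset (Fin (h + 1)))), (∏ c : ↥T, P' (g c) c) *
        ∏ a : ↥(∅ : Finset (Fin (h + 1))),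
          ((Finset.univ.filter fun c : ↥T => g c = a).card.factorial : ℂ[X]))).coeff 0 = 0 := by
  classical
  rw [segSumR_singleton, segSumR_empty, Finset.prod_congr rfl (fun c _ => hlast c), prod_X_mul_C]
  by_cases hT : T = ∅
  · subst hT
    simp
  · rw [if_neg hT, sub_zero, ← mul_assoc, ← Polynomial.C_eq_natCast, ← map_mul,
      Polynomial.coeff_C_mul_X_pow, if_neg]
    exact fun e => hT (Finset.card_eq_zero.mp e.symm)

/-- **Row `{last}` minus row `∅`, coefficient of `X¹`** = the first-order row
`Σ_{c∈T} Q_c · segEntry Pb ∅ (T ∖ {c})` (= `Q_c` if `T = {c}`, else `0`). -/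
theorem coeff_one_sub_partner_single (hlast : ∀ c, P' (Fin.last h) c = Polynomial.X * Polynomial.C (Q c))
    (T : Finset (Fin (h + 1))) :
    ((∑ g : (↥T → ↥({Fin.last h} : Finset (Fin (h + 1)))), (∏ c : ↥T, P' (g c) c) *
        ∏ a : ↥({Fin.last h} : Finset (Fin (h + 1))),
          ((Finset.univ.filter fun c : ↥T => g c = a).card.factorial : ℂ[X])) -
      (∑ g : (↥T → ↥(∅ : Finset (Fin (h + 1)))), (∏ c : ↥T, P' (g c) c) *
        ∏ a : ↥(∅ : Finset (Fin (h + 1))),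
          ((Finset.univ.filter fun c : ↥T => g c = a).card.factorial : ℂ[X]))).coeff 1 =
      ∑ c ∈ T, Q c *
        ∑ g : (↥(T.erase c) → ↥(∅ : Finset (Fin (h + 1)))), (∏ c' : ↥(T.erase c), Pb (g c') c') *
          ∏ a : ↥(∅ : Finset (Fin (h + 1))),
            ((Finset.univ.filter fun c' : ↥(T.erase c) => g c' = a).card.factorial : ℂ) := by
  classical
  rw [segSumR_singleton, segSumR_empty, Finset.prod_congr rfl (fun c _ => hlast c), prod_X_mul_C]
  simp_rw [segSumR_empty]
  by_cases hT : T = ∅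
  · subst hT
    simp
  · rw [if_neg hT, sub_zero]
    -- LHS: coefficient of `X` in `|T|!·(C(∏Q)·X^{|T|})`
    rw [← mul_assoc, ← Polynomial.C_eq_natCast, ← map_mul, Polynomial.coeff_C_mul_X_pow]
    obtain ⟨c₀, hc₀⟩ := Finset.nonempty_iff_ne_empty.mpr hT
    by_cases h1 : T.card = 1
    · obtain ⟨c, rfl⟩ := Finset.card_eq_one.mp h1
      simp
    · rw [if_neg (Ne.symm h1)]
      symm
      refine Finset.sum_eq_zero fun c hc => ?_
      have hcard : T.card ≠ 0 := fun e => hT (Finset.card_eq_zero.mp e)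
      have hne : T.erase c ≠ ∅ := by
        intro e
        have := Finset.card_erase_of_mem hc
        rw [e, Finset.card_empty] at this
        omega
      rw [if_neg hne, mul_zero]

/-- The pair row `{a, last}` over `ℂ[X]` as a polynomial in `X`:
`Σ_{d ⊆ T} C(|d|!|T∖d|!·(∏_d Pb_a)(∏_{T∖d} Q))·X^{|T∖d|}`. -/
theorem segSum_pair_last_eq (a : Fin (h + 1)) (ha : a ≠ Fin.last h)
    (hlast : ∀ c, P' (Fin.last h) c = Polynomial.X * Polynomial.C (Q c))
    (hother : ∀ c, P' a c = Polynomial.C (Pb a c)) (T : Finset (Fin (h + 1))) :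
    (∑ g : (↥T → ↥({a, Fin.last h} : Finset (Fin (h + 1)))), (∏ c : ↥T, P' (g c) c) *
        ∏ a' : ↥({a, Fin.last h} : Finset (Fin (h + 1))),
          ((Finset.univ.filter fun c : ↥T => g c = a').card.factorial : ℂ[X])) =
      ∑ d ∈ T.powerset, Polynomial.C ((d.card.factorial : ℂ) * ((T \ d).card.factorial : ℂ) *
        ((∏ c ∈ d, Pb a c) * ∏ c ∈ T \ d, Q c)) * Polynomial.X ^ (T \ d).card := by
  classical
  rw [segSumR_pair P' a (Fin.last h) ha T]
  refine Finset.sum_congr rfl fun d _ => ?_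
  rw [Finset.prod_congr rfl (fun c _ => hother c), Finset.prod_congr rfl (fun c _ => hlast c),
    prod_C, prod_X_mul_C]
  simp only [map_mul, map_natCast]
  ring

/-- **Row `{a, last}` minus row `{a}`, constant coefficient**: it vanishes (at `X = 0` the last point
sits at the origin and the pair row degenerates to the single row). -/
theorem coeff_zero_sub_partner_pair (a : Fin (h + 1)) (ha : a ≠ Fin.last h)
    (hlast : ∀ c, P' (Fin.last h) c = Polynomial.X * Polynomial.C (Q c))
    (hother : ∀ c, P' a c = Polynomial.C (Pb a c)) (T : Finset (Fin (h + 1))) :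
    ((∑ g : (↥T → ↥({a, Fin.last h} : Finset (Fin (h + 1)))), (∏ c : ↥T, P' (g c) c) *
        ∏ a' : ↥({a, Fin.last h} : Finset (Fin (h + 1))),
          ((Finset.univ.filter fun c : ↥T => g c = a').card.factorial : ℂ[X])) -
      (∑ g : (↥T → ↥({a} : Finset (Fin (h + 1)))), (∏ c : ↥T, P' (g c) c) *
        ∏ a' : ↥({a} : Finset (Fin (h + 1))),
          ((Finset.univ.filter fun c : ↥T => g c = a').card.factorial : ℂ[X]))).coeff 0 = 0 := by
  classical
  rw [segSum_pair_last_eq P' Pb Q a ha hlast hother, segSumR_singleton,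
    Finset.prod_congr rfl (fun c _ => hother c), prod_C, Polynomial.coeff_sub,
    Polynomial.finsetSum_coeff]
  simp_rw [Polynomial.coeff_C_mul_X_pow]
  rw [Finset.sum_ite, Finset.sum_const_zero, add_zero]
  have hfilter : T.powerset.filter (fun d => 0 = (T \ d).card) = {T} := by
    ext d
    simp only [Finset.mem_filter, Finset.mem_powerset, Finset.mem_singleton]
    constructor
    · rintro ⟨hdT, hcard⟩
      exact (Finset.eq_of_subset_of_card_le hdT (by
        have := Finset.card_sdiff_add_card_eq_card hdT
        omega))
    · rintro rfl
      exact ⟨Finset.Subset.refl _, by simp⟩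
  rw [hfilter, Finset.sum_singleton, Finset.sdiff_self, Finset.card_empty, Nat.factorial_zero,
    Finset.prod_empty, ← Polynomial.C_eq_natCast, ← map_mul, Polynomial.coeff_C_zero]
  push_cast
  ring

/-- **Row `{a, last}` minus row `{a}`, coefficient of `X¹`** = the first-order row
`Σ_{c∈T} Q_c · segEntry Pb {a} (T ∖ {c})`. -/
theorem coeff_one_sub_partner_pair (a : Fin (h + 1)) (ha : a ≠ Fin.last h)
    (hlast : ∀ c, P' (Fin.last h) c = Polynomial.X * Polynomial.C (Q c))
    (hother : ∀ c, P' a c = Polynomial.C (Pb a c)) (T : Finset (Fin (h + 1))) :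
    ((∑ g : (↥T → ↥({a, Fin.last h} : Finset (Fin (h + 1)))), (∏ c : ↥T, P' (g c) c) *
        ∏ a' : ↥({a, Fin.last h} : Finset (Fin (h + 1))),
          ((Finset.univ.filter fun c : ↥T => g c = a').card.factorial : ℂ[X])) -
      (∑ g : (↥T → ↥({a} : Finset (Fin (h + 1)))), (∏ c : ↥T, P' (g c) c) *
        ∏ a' : ↥({a} : Finset (Fin (h + 1))),
          ((Finset.univ.filter fun c : ↥T => g c = a').card.factorial : ℂ[X]))).coeff 1 =
      ∑ c ∈ T, Q c *
        ∑ g : (↥(T.erase c) → ↥({a} : Finset (Fin (h + 1)))), (∏ c' : ↥(T.erase c), Pb (g c') c') *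
          ∏ a' : ↥({a} : Finset (Fin (h + 1))),
            ((Finset.univ.filter fun c' : ↥(T.erase c) => g c' = a').card.factorial : ℂ) := by
  classical
  rw [segSum_pair_last_eq P' Pb Q a ha hlast hother, segSumR_singleton,
    Finset.prod_congr rfl (fun c _ => hother c), prod_C, Polynomial.coeff_sub,
    Polynomial.finsetSum_coeff]
  simp_rw [Polynomial.coeff_C_mul_X_pow, segSumR_singleton]
  rw [← Polynomial.C_eq_natCast, ← map_mul, Polynomial.coeff_C, if_neg (by norm_num : (1 : ℕ) ≠ 0),
    sub_zero, Finset.sum_ite, Finset.sum_const_zero, add_zero]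
  -- the subsets `d ⊆ T` with `|T ∖ d| = 1` are exactly the `T.erase c`, `c ∈ T`
  have himage : T.powerset.filter (fun d => 1 = (T \ d).card) = T.image fun c => T.erase c := by
    ext d
    simp only [Finset.mem_filter, Finset.mem_powerset, Finset.mem_image]
    constructor
    · rintro ⟨hdT, hcard⟩
      obtain ⟨c, hc⟩ := Finset.card_eq_one.mp hcard.symm
      refine ⟨c, ?_, ?_⟩
      · have : c ∈ T \ d := by rw [hc]; exact Finset.mem_singleton_self c
        exact (Finset.mem_sdiff.mp this).1
      · rw [← Finset.sdiff_sdiff_eq_self hdT, hc, Finset.sdiff_singleton_eq_erase]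
    · rintro ⟨c, hc, rfl⟩
      refine ⟨Finset.erase_subset _ _, ?_⟩
      rw [Finset.sdiff_erase hc, Finset.sdiff_self, Finset.insert_empty, Finset.card_singleton]
  rw [himage, Finset.sum_image (fun c hc c' hc' e => Finset.erase_injOn T hc hc' e)]
  refine Finset.sum_congr rfl fun c hc => ?_
  rw [Finset.sdiff_erase hc, Finset.sdiff_self, Finset.insert_empty, Finset.card_singleton,
    Finset.prod_singleton, Finset.card_erase_of_mem hc, Nat.factorial_one]
  push_cast
  ring

end Expansion

end Summit.ValiantsHypothesis.ValiantsHypothesis.Theorems.BarrierLever.ChowBenchmarkFirstOrder
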